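import Summits.Ventures.HodgeRepro2.T6PeriodInput6
import Summits.Ventures.HodgeRepro2.T6N3WitInstance
import Summits.Ventures.HodgeRepro2.T6N43BergmanNSide
import Summits.Ventures.HodgeRepro2.T6N5Toy

/-!
# T6PeriodInput6Toy2 — THE JOINT TOY v2: the M2 v6 theorem on a `NAut3` carrier whose N1 side is
t6-p1's NON-DEGENERATE instance (every binder a theorem on the toy; the §10.5(ii)(d) witness of M2)

Cell pub-hodge-repro2, Tier 6 (README §10), seat t6-p6 (the (γ) assembly file of the t6-lead's word,
STATUS ll. 11316 (4)(b) / 11351 (2) / 11364 (1); section ownership: the lead's L4, TARGET-T6 §9; the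
lead reviews the bytes before the §10.5(ii)(d) declaration). Proof lane; count-neutral.

THE CARRIER `toy2 D σ₀ : NAut3 F (D.ndatum σ₀)` (t6-p1's spec (S1)–(S7), STATUS l. 11284, adopted
l. 11316 (4)) over t6-p1's period datum `N1Wit.WitData.ndatum D σ₀` (T6N1WitMain: choices `ℂ⁴`,
admissible = NORMALISED `c.1 · c.2.1 = 1 ∧ c.2.2.1 · c.2.2.2 = 1`, the doubled surface shadow):
* `d1` := t6-p1's N1 datum `D.n1datum σ₀` (conjugation `conj2`, `H10 = ι(U)`, the re-cut dictionary
  `scP`, `c_K = 1`) — its parameters `D.FA σ₀ c = (c.1 c.2.1) • f_A`, `D.FB σ₀ c = (c.2.2.1 c.2.2.2) • f_B`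
  ARE, definitionally, the products of the N3 datum below at the Schwartz data of `c` (`data := id`;
  t6-p3's `witN3_A_F` / `witN3_B_F` / `witN3_pairing`, all `rfl`);
* `d3` := t6-p3's (β) datum `N3WitInstance.witN3 D σ₀ = N3ToyV.toyVW (LGw K) f_A f_B` (T6N3WitInstance /
  T6N3Toy2V: the toy N3 datum on `LG = ℓ²(pair indices)` with side A on `f_A = scP ω_A`, side B on
  `f_B = scP ω_B`, `F_A φa φb = (φa φb) • f_A`, `F_B φc φd = (φc φd) • f_B`, trivial `G(𝔸_f)`);
* `d2` := t6-p3's `N3WitInstance.witN2 D σ₀` = t6-p5's explicit-isometry N2 datum at the ℚ-RATIONAL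
  admissible sets `N2ToyIsoS.toyIsoSF F P witN3 ratSet ratSet ratSet ratSet` (T6N2ToyIsoS p406920;
  `N3ToyV.ratSet` p407419 = `Set.range ((↑) : ℚ → ℂ)`, ℚ-closed, ℂ-spanning, NOT ℂ-scaling-closed —
  the record's admissible sets are ℚ-forms, t6-p5 l. 11271 (2), adopted l. 11316 (2); t6-p1's
  obstruction `T6N1Obstruction` / `…2` has no purchase on them);
* `data_adm'` := t6-p3's `data_adm'_witness` — the unit choice `c = (1, 1, 1, 1)` under the normalised
  `AdmChoice` (no scaling, no realisation of data is promised);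
* `sA = sB` := `N43Toy.bergmanNSide` (T6N43BergmanNSide p406830: t6-p5's consistent N4 side with the
  archimedean (1,1)-places the weight-3 Bergman model, `d43 = bergmanToy.toPlaces`), the explicit
  bundles `XA = XB = bergmanToy` with `hxA = hxB = rfl`;
* `d5` := t6-p7's two-element toy N5 datum `N5Toy.toyData` (`ι5 = Unit`, `G5 = Multiplicative ℤ`), as
  in the v4 / v6 composition-check toys (T6PeriodInput4Toy p405821, T6PeriodInput6Toy).

THE THEOREM `toy2_periodInputN_of_published₆`: `periodInputN_of_published₆` (T6PeriodInput6 p407424, the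
declared M2 v6 object) fires on `toy2 D σ₀` with EVERY binder a theorem on the toy — the four N1
displays INCLUDED (t6-p1's `N1Wit.WitData.displays`: Voisin 2002 7.3.2, Voisin 2002 Lemma 5.4 /
Petersson, Liu 2021 Prop. 4.13 A / B hold JOINTLY on `n1datum`), N2's explicit shape
(`toyIsoSF_explicitShape`), the three Rogawski displays on `N3Toy.toyR`, the Gan–Takeda display on
`N3Toy.toyS`, the N3.L8 / N3A / N3B interface Props on `witN3` (t6-p3), the N4.1–N4.3 displays and
bridges on `bergmanNSide` / `toyD41` (t6-p4 / t6-p5 / t6-p6), BFGYYZ 2025 Thm 5.6 on `toyData`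
(t6-p7) — and the conclusion `∃ c, AdmChoice c ∧ Hyp.PeriodN (shadow c)` holds with the period
non-zero at every choice (`toy2_conclusion_holds` = t6-p1's `periodN`). The instance is
NON-DEGENERATE: the carrier's pairing at the unit choice is `⟪f_B, f_A⟫ ≠ 0`
(`toy2_pairing_one_ne_zero`, from t6-p1's `pairing_ne_zero` through `N1Main.I_eq`), so `f_A ≠ 0`
and `f_B ≠ 0` are theorems (t6-p3's `fA_ne_zero` / `fB_ne_zero`); the period is non-zero at every
choice (`toy2_conclusion_holds`).

THE (α) SCALAR `f_B ∈ ℂ ∙ f_A` (the proportionality of the two parameters) IS A THEOREM: FORCED by the N3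
interface on any datum with one-line products (t6-p3's `T6N3TrivGroup` `B_F_mem_span_A_F` /
`span_eq_of_products_on_lines`, ll. 11327 (3) / 11339 (1)); NOT provable on the orthonormal dictionary
`sc` of T6N1WitGram (p407763) — its adjoint vector `sc ω_B` has up to nine first-copy components
(t6-p1 l. 11398 (2), the lead's ruling l. 11364 (1)); SUPPLIED by t6-p1's RE-CUT dictionary `scP`
(T6N1WitGram2 / T6N1WitGram3 / the re-cut T6N1WitMain: a rank factorisation of the block
`M p q = λ₁(e_p · conj2 e_q)` with `sc e_{q_B} = conj M₀ • f_{p_A}`, so `scP ω_B = l • scP ω_A` with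
`l ≠ 0` — `WitData.scP_omegaB_eq_smul`, `scP_omegaA_ne_zero`, t6-p1 l. 11398 (1)), and exported by (β)
as `N3WitInstance.witN3_hw` (t6-p3 l. 11407). NO hypothesis anywhere: every statement of this file is
a theorem of `D : WitData F` and `σ₀ : K →+* ℂ`.

§8(d): uses an L-value-free non-vanishing device: NO.
-/

namespace Summit.Ventures.HodgeRepro2.T6.PeriodInput6Toy2

open scoped InnerProductSpace
open N1Wit N1Wit.WitData N3WitInstance N3ToyV N3Toy N2ToyIso N2ToyIsoS N42Toy N42ToyNSide N43Toy N5Toy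

variable {K : Type} [Field K] [NumberField K] [NumberField.IsCMField K] {F : FaceSetting K}

/-! ## 1. The carrier -/

section Carrier

variable (D : WitData F) (σ₀ : K →+* ℂ)

/-- THE JOINT TOY v2 CARRIER over t6-p1's period datum: N3 = t6-p3's `witN3` (= `toyVW (LGw K) f_A f_B`),
`data = id`, N2 = t6-p3's `witN2` (t6-p5's explicit-isometry datum at the ℚ-rational sets),
`data_adm'` = t6-p3's unit-choice witness, N1 = t6-p1's `n1datum`, N4 = `bergmanNSide` on both sides,
N5 = `N5Toy.toyData`. -/
noncomputable def toy2 : NAut3 F (D.ndatum σ₀) where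
  d3 := witN3 D σ₀
  data c := c
  d2 := witN2 D σ₀
  data_adm' _ φa φb φc φd _ hne := data_adm'_witness D σ₀ φa φb φc φd hne
  d1 := D.n1datum σ₀
  sA := bergmanNSide
  sB := bergmanNSide
  ι5 := Unit
  G5 := Multiplicative ℤ
  d5 := N5Toy.toyData
  hypII_A_of_N5 _ := toyV_hypII (fA D σ₀)
  hypII_B_of_N5 _ := toyV_hypII (fB D σ₀)

/-- The carrier's N3 datum is t6-p3's `witN3`. -/
theorem toy2_d3 : (toy2 D σ₀).d3 = witN3 D σ₀ := rfl

/-- The carrier's N2 datum is t6-p3's `witN2`. -/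
theorem toy2_d2 : (toy2 D σ₀).d2 = witN2 D σ₀ := rfl

/-- The carrier's N1 datum is t6-p1's. -/
theorem toy2_d1 : (toy2 D σ₀).d1 = D.n1datum σ₀ := rfl

/-- The carrier's pairing is t6-p1's. -/
theorem toy2_pairing (c : (D.ndatum σ₀).Choice) : (toy2 D σ₀).pairing c = (D.n1datum σ₀).pairing c :=
  rfl

/-- The carrier's pairing at the unit choice is `⟪f_B, f_A⟫ ≠ 0`: the instance is NON-DEGENERATE. -/
theorem toy2_pairing_one_ne_zero : (toy2 D σ₀).pairing (1, 1, 1, 1) ≠ 0 :=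
  D.pairing_ne_zero σ₀ (1, 1, 1, 1) (admChoice_one D σ₀)

/-- `hex`: every quadruple of Schwartz data is the data of a choice (`data = id`). -/
theorem toy2_hex : ∀ (φa : (toy2 D σ₀).d3.A.Sa) (φb : (toy2 D σ₀).d3.A.Sb)
    (φc : (toy2 D σ₀).d3.B.Sa) (φd : (toy2 D σ₀).d3.B.Sb),
    ∃ c, (toy2 D σ₀).data c = (φa, φb, φc, φd) :=
  fun φa φb φc φd => ⟨(φa, φb, φc, φd), rfl⟩

/-- GQT Thm 11.7(ii) on the carrier's side A and the toy doubling-L datum: `σ_A = ℂ ∙ f_A ≠ ⊥`. -/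
theorem toy2_thm11_7_A : Hyp.GQT2014_Thm11_7_ii (toy2 D σ₀).d3.A (toy2 D σ₀).sA.d41 :=
  fun _ _ h => fA_ne_zero D σ₀ (Submodule.span_singleton_eq_bot.mp h)

/-- GQT Thm 11.7(ii) on the carrier's side B: `σ_B = ℂ ∙ f_B ≠ ⊥`. -/
theorem toy2_thm11_7_B : Hyp.GQT2014_Thm11_7_ii (toy2 D σ₀).d3.B (toy2 D σ₀).sB.d41 :=
  fun _ _ h => fB_ne_zero D σ₀ (Submodule.span_singleton_eq_bot.mp h)

/-- Theorem 5.6's display on the two sides of the toy N5 datum (both the trivial side). -/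
theorem toyData_thm5_6 :
    Hyp.BFGYYZ2025_Thm5_6
      ({N5Toy.toyData.A, N5Toy.toyData.B} : Set (N5Skeleton.ToricSide Unit (Multiplicative ℤ))) := by
  intro X hX
  simp only [Set.mem_insert_iff, Set.mem_singleton_iff] at hX
  rcases hX with rfl | rfl <;> exact toySide_dichotomy

end Carrier

/-! ## 2. The M2 v6 theorem on the joint toy v2 -/

section Main

variable (D : WitData F) (σ₀ : K →+* ℂ)

/-- THE M2 v6 OBJECT FIRES ON THE JOINT TOY v2 WITH EVERY BINDER A THEOREM ON THE TOY — the four N1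
displays included (t6-p1's `displays`) and the (α) scalar included (t6-p3's `witN3_hw`):
`periodInputN_of_published₆` applied to `toy2 D σ₀`, NO hypothesis. The conclusion is
`∃ c, AdmChoice c ∧ Hyp.PeriodN (shadow c)` on t6-p1's datum, where the period is non-zero at every
choice. -/
theorem toy2_periodInputN_of_published₆ :
    ∃ c, (D.ndatum σ₀).AdmChoice c ∧ Hyp.PeriodN ((D.ndatum σ₀).shadow c) := by
  obtain ⟨hR0, hR1, hR2, hs, hRbr, hO, hsimp, hPX, hPeqX, hPY, hPeqY, hσX, hσ⟩ :=
    witN3_N3iso_binders D σ₀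
  exact periodInputN_of_published₆ (toy2 D σ₀) (toy2_hex D σ₀)
    -- N2: the explicit shape of t6-p5's datum (no display)
    (isCMFrame_frameOf F.deg6) (isLiuSignElement_e111Of (isCMFrame_frameOf F.deg6))
    (magSpec_uOf (isCMFrame_frameOf F.deg6)) rfl
    -- N3iso: the sentence N2 and N3 share (ℚ-rational sets ℂ-span), Rogawski on `toyR`, the
    -- dictionary and the N3.L8 interface Props on `witN3` (t6-p3's package)
    (witN2_admGenerating D σ₀) toyR hR0 hR1 hR2 hs (toyVW_AutStable _ _) hRbr hO hsimp hPX hPeqX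
    hPY hPeqY hσX hσ
    -- N1: THE FOUR DISPLAYS, THEOREMS on t6-p1's datum
    (D.displays σ₀).1 (D.displays σ₀).2.1 (D.displays σ₀).2.2.1 (D.displays σ₀).2.2.2
    -- N3A (t6-p3's side-level instances on `sideV (LGw K) f_A`)
    (fun _ : Unit => toyS) (fun _ => toyS_ganTakeda) (toyVW_HoweDualityBridge_A (fA D σ₀) (fB D σ₀))
    (toyV_KliftCont (fA D σ₀)) (toyV_Seam (fA D σ₀)) (toyV_Adjoint (fA D σ₀))
    (toyV_KliftLevel (fA D σ₀)) (toyV_ThetaTauType (fA D σ₀)) (toyV_CopiesEquivariant (fA D σ₀))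
    (toyV_CopiesOrthogonal (fA D σ₀)) (toyV_CopiesIncl (fA D σ₀)) (toyV_CopiesTauType (fA D σ₀))
    (toyV_TauTypeDecomposes (fA D σ₀)) (toyV_LevelPartFinite (fA D σ₀))
    (toyV_LevelPartCont (fA D σ₀)) (toyV_KAverage (fA D σ₀)) (toyV_ThetaEquivariant (fA D σ₀))
    (toyV_SpanOfFixedVector (fA D σ₀)) (toyV_CrossCopyOrthogonal (fA D σ₀))
    (toyV_CopyIndependence (fA D σ₀)) (toyV_TensorsSpan (fA D σ₀))
    -- N3B (the same on `sideV (LGw K) f_B`)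
    (fun _ : Unit => toyS) (fun _ => toyS_ganTakeda) (toyVW_HoweDualityBridge_B (fA D σ₀) (fB D σ₀))
    (toyV_KliftCont (fB D σ₀)) (toyV_Seam (fB D σ₀)) (toyV_Adjoint (fB D σ₀))
    (toyV_KliftLevel (fB D σ₀)) (toyV_ThetaTauType (fB D σ₀)) (toyV_CopiesEquivariant (fB D σ₀))
    (toyV_CopiesOrthogonal (fB D σ₀)) (toyV_CopiesIncl (fB D σ₀)) (toyV_CopiesTauType (fB D σ₀))
    (toyV_TauTypeDecomposes (fB D σ₀)) (toyV_LevelPartFinite (fB D σ₀))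
    (toyV_LevelPartCont (fB D σ₀)) (toyV_KAverage (fB D σ₀)) (toyV_ThetaEquivariant (fB D σ₀))
    (toyV_SpanOfFixedVector (fB D σ₀)) (toyV_CrossCopyOrthogonal (fB D σ₀))
    (toyV_CopyIndependence (fB D σ₀)) (toyV_TensorsSpan (fB D σ₀))
    -- N4: the Bergman-explicit bundles (`d43 = bergmanToy.toPlaces` by `rfl`)
    bergmanToy bergmanToy rfl rfl
    -- N4, side A: N4.2 (t6-p5's toy instances)
    ⟨fun _ => ⟨toyPair_irreducible, toyPair_smooth⟩, fun _ => ⟨trivial_irreducible, trivial_smooth⟩⟩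
    (fun _ => Nat.zero_lt_succ 1) (fun _ => Nat.le_succ 2) (fun _ => toyTower_firstLift)
    (fun _ => toyTypeII_minguez) (fun _ => toyTower_ganIchino)
    -- side A: N4.3 (t6-p6's instances; the Eischen–Liu binders on `toyD41.Lv (Sum.inr j)`)
    bergmanNSide_EL₁ bergmanNSide_A2f₂ bergmanNSide_EL₂ bergmanNSide_A2f₃ bergmanNSide_EL₃
    -- side A: the three «obvious» bridges, N4.1 (t6-p5's instances on `toyD41`), `hunr`, the Rallis
    -- bridge on the carrier's side A, the τ′-refinement
    (bergmanNSide_conj11_5 _ 0) (bergmanNSide_conj11_5 _ 1) (bergmanNSide_conj11_5 _ 2)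
    toyD41_GQT toyD41_LR toyD41_padic toyD41_eulerE₁ toyD41_eulerE₂ toyD41_thm31₁ toyD41_thm31₂
    toyD41_prop44₁ toyD41_prop44₂ toyD41_hunr (toy2_thm11_7_A D σ₀)
    (fun _ => toyV_hypI (fA_ne_zero D σ₀))
    -- N4, side B: the same
    ⟨fun _ => ⟨toyPair_irreducible, toyPair_smooth⟩, fun _ => ⟨trivial_irreducible, trivial_smooth⟩⟩
    (fun _ => Nat.zero_lt_succ 1) (fun _ => Nat.le_succ 2) (fun _ => toyTower_firstLift)
    (fun _ => toyTypeII_minguez) (fun _ => toyTower_ganIchino)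
    bergmanNSide_EL₁ bergmanNSide_A2f₂ bergmanNSide_EL₂ bergmanNSide_A2f₃ bergmanNSide_EL₃
    (bergmanNSide_conj11_5 _ 0) (bergmanNSide_conj11_5 _ 1) (bergmanNSide_conj11_5 _ 2)
    toyD41_GQT toyD41_LR toyD41_padic toyD41_eulerE₁ toyD41_eulerE₂ toyD41_thm31₁ toyD41_thm31₂
    toyD41_prop44₁ toyD41_prop44₂ toyD41_hunr (toy2_thm11_7_B D σ₀)
    (fun _ => toyV_hypI (fB_ne_zero D σ₀))
    -- N5 (t6-p7's toy instances)
    toyData_thm5_6 ⟨toySide_levelReduction, toySide_levelReduction⟩ ⟨toySide_condA, toySide_condA⟩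
    ⟨toySide_condB, toySide_condB⟩ ⟨toySide_condC, toySide_condC⟩

omit [NumberField.IsCMField K] in
/-- The conclusion on the toy is NOT vacuous: the shadow of every choice satisfies the displayed (N)
(t6-p1's `periodN`: the period is non-zero at every choice). -/
theorem toy2_conclusion_holds (c : (D.ndatum σ₀).Choice) :
    Hyp.PeriodN ((D.ndatum σ₀).shadow c) :=
  D.periodN σ₀ c

end Main

end Summit.Ventures.HodgeRepro2.T6.PeriodInput6Toy2
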